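import Literature.Analysis.Potential.HarmonicPolynomialGaussianMeanValue
import Mathlib
import HarnessLib

/-!
# Hecke's identity: the Fourier–Laplace transform of (harmonic homogeneous polynomial) × Gaussian

For a real harmonic homogeneous polynomial `H` of degree `k` on `ℝⁿ`, `b > 0`, `ξ ∈ ℝⁿ` and EVERY COMPLEX `s`:

  ★ `integral_eval_mul_cexp_inner`:  `∫_{ℝⁿ} H(x) e^{−b‖x‖² + s⟪ξ,x⟫} dx = (π/b)^{n/2} e^{s²‖ξ‖²/(4b)} (s/(2b))^k H(ξ)`.

At `s = −i` this is HECKE'S IDENTITY (Bochner–Hecke for Gaussians) [cite: SteinWeiss1971, Ch. IV Thm. 3.4]: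

  ★ `hecke_identity`:  `∫_{ℝⁿ} H(x) e^{−b‖x‖²} e^{−i⟪ξ,x⟫} dx = (π/b)^{n/2} (−i/(2b))^k H(ξ) e^{−‖ξ‖²/(4b)}`,

i.e. `H(x)e^{−b‖x‖²}` is an eigenfunction of the Fourier transform up to the Gaussian rescaling (Stein–Weiss' normalisation `b = π`,
`𝓕(P e^{−π|x|²}) = i^{−k} P e^{−π|ξ|²}`, is the case `s = −2πi`).  PROOF: for real `s` the identity is the Gaussian mean-value property of
harmonic polynomials (✓ `Literature.Analysis.Potential.integral_eval_mul_exp_inner`, completing the square); both sides are ENTIRE in `s`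
(the left by differentiation under the integral sign with the Gaussian domination `e^{−b‖x‖²+R|⟪ξ,x⟫|} ≤ e^{R²‖ξ‖²/(2b)} e^{−b‖x‖²/2}`), so
they agree on `ℂ` by the identity theorem (`AnalyticOnNhd.eq_of_frequently_eq`).  No differential-operator calculus is used.
Mathlib has the Gaussian Fourier transform (`fourier_gaussian_innerProductSpace`) but not Hecke's identity / Bochner–Hecke.
-/

set_option autoImplicit false

noncomputable section

namespace Literature.Analysis.Fourier

open MvPolynomial _root_.MeasureTheory _root_.Complex Filter
open scoped BigOperators RealInnerProductSpace _root_.Topology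
open Literature.Analysis.Potential (integral_eval_mul_exp_inner)

variable {n : ℕ}

/-! ## § 1. Gaussian domination (private) -/

/-- The Gaussian `e^{−a‖x‖²}` is integrable on `ℝⁿ` (`a > 0`). [folklore] -/
private theorem integrable_exp_neg_mul_sq_norm'' {a : ℝ} (ha : 0 < a) :
    Integrable (fun x : EuclideanSpace ℝ (Fin n) => Real.exp (-(a * ‖x‖ ^ 2))) := by
  refine Integrable.of_integral_ne_zero (fun h => ?_)
  have h1 := GaussianFourier.integral_rexp_neg_mul_sq_norm (V := EuclideanSpace ℝ (Fin n)) ha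
  have h2 : (fun v : EuclideanSpace ℝ (Fin n) => Real.exp (-a * ‖v‖ ^ 2)) = fun v => Real.exp (-(a * ‖v‖ ^ 2)) := by
    funext v; ring_nf
  rw [h2, h] at h1
  have : (0 : ℝ) < (Real.pi / a) ^ (Module.finrank ℝ (EuclideanSpace ℝ (Fin n)) / 2 : ℝ) := by positivity
  linarith

/-- Polynomial functions times Gaussians are integrable (private copy). [folklore] -/
private theorem integrable_eval_mul_exp'' (P : MvPolynomial (Fin n) ℝ) {a : ℝ} (ha : 0 < a) :
    Integrable (fun x : EuclideanSpace ℝ (Fin n) => eval (WithLp.ofLp x) P * Real.exp (-(a * ‖x‖ ^ 2))) := by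
  induction P using MvPolynomial.induction_on generalizing a with
  | C c =>
    simpa using (integrable_exp_neg_mul_sq_norm'' ha).const_mul c
  | add p q hp hq =>
    refine ((hp ha).add (hq ha)).congr (Filter.Eventually.of_forall fun x => ?_)
    simp only [Pi.add_apply, map_add, add_mul]
  | mul_X p i hp =>
    have ha2 : 0 < a / 2 := by positivity
    have hmeas : AEStronglyMeasurable (fun x : EuclideanSpace ℝ (Fin n) => x i * Real.exp (-(a / 2 * ‖x‖ ^ 2))) volume := by
      have : Continuous fun x : EuclideanSpace ℝ (Fin n) => x i * Real.exp (-(a / 2 * ‖x‖ ^ 2)) := by fun_prop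
      exact this.aestronglyMeasurable
    have hbd : ∀ x : EuclideanSpace ℝ (Fin n), |x i| * Real.exp (-(a / 2 * ‖x‖ ^ 2)) ≤ (1 + 1 / (a / 2)) / 2 := by
      intro x
      have hxi : |x i| ≤ ‖x‖ := by
        have := PiLp.norm_apply_le x i
        rwa [Real.norm_eq_abs] at this
      have hexp1 : Real.exp (-(a / 2 * ‖x‖ ^ 2)) ≤ 1 := by
        rw [Real.exp_le_one_iff]; nlinarith [norm_nonneg x]
      have hexp2 : a / 2 * ‖x‖ ^ 2 * Real.exp (-(a / 2 * ‖x‖ ^ 2)) ≤ 1 := by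
        have h := Real.add_one_le_exp (a / 2 * ‖x‖ ^ 2)
        have hpos : 0 < Real.exp (a / 2 * ‖x‖ ^ 2) := Real.exp_pos _
        rw [Real.exp_neg, mul_inv_le_iff₀ hpos]
        nlinarith [norm_nonneg x]
      have hamgm : ‖x‖ ≤ (1 + ‖x‖ ^ 2) / 2 := by nlinarith [sq_nonneg (‖x‖ - 1)]
      have he0 : 0 ≤ Real.exp (-(a / 2 * ‖x‖ ^ 2)) := (Real.exp_pos _).le
      calc |x i| * Real.exp (-(a / 2 * ‖x‖ ^ 2))
          ≤ (1 + ‖x‖ ^ 2) / 2 * Real.exp (-(a / 2 * ‖x‖ ^ 2)) := mul_le_mul_of_nonneg_right (hxi.trans hamgm) he0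
        _ = (Real.exp (-(a / 2 * ‖x‖ ^ 2)) + (1 / (a / 2)) * (a / 2 * ‖x‖ ^ 2 * Real.exp (-(a / 2 * ‖x‖ ^ 2)))) / 2 := by
            field_simp
        _ ≤ (1 + (1 / (a / 2)) * 1) / 2 := by gcongr
        _ = (1 + 1 / (a / 2)) / 2 := by ring
    have h := (hp ha2).mul_bdd hmeas (c := (1 + 1 / (a / 2)) / 2)
      (Filter.Eventually.of_forall fun x => by
        rw [Real.norm_eq_abs, abs_mul, abs_of_pos (Real.exp_pos _)]
        exact hbd x)
    refine h.congr (Filter.Eventually.of_forall fun x => ?_)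
    simp only [map_mul, eval_X]
    have : Real.exp (-(a * ‖x‖ ^ 2)) = Real.exp (-(a / 2 * ‖x‖ ^ 2)) * Real.exp (-(a / 2 * ‖x‖ ^ 2)) := by
      rw [← Real.exp_add]; ring_nf
    rw [this]; ring

/-- **Gaussian domination of a complex linear exponent**: for `‖s‖ ≤ R`,
`‖e^{−b‖x‖² + s⟪ξ,x⟫}‖ ≤ e^{R²‖ξ‖²/(2b)} · e^{−(b/2)‖x‖²}` (AM–GM: `R‖ξ‖‖x‖ ≤ (b/2)‖x‖² + R²‖ξ‖²/(2b)`). [folklore] -/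
private theorem norm_cexp_quadratic_le {b : ℝ} (hb : 0 < b) (ξ x : EuclideanSpace ℝ (Fin n)) {R : ℝ} {s : ℂ} (hs : ‖s‖ ≤ R) :
    ‖Complex.exp (((-(b * ‖x‖ ^ 2) : ℝ) : ℂ) + s * ((⟪ξ, x⟫ : ℝ) : ℂ))‖
      ≤ Real.exp (R ^ 2 * ‖ξ‖ ^ 2 / (2 * b)) * Real.exp (-(b / 2 * ‖x‖ ^ 2)) := by
  rw [Complex.norm_exp, ← Real.exp_add]
  apply Real.exp_le_exp.mpr
  have hre : (((-(b * ‖x‖ ^ 2) : ℝ) : ℂ) + s * ((⟪ξ, x⟫ : ℝ) : ℂ)).re = -(b * ‖x‖ ^ 2) + s.re * ⟪ξ, x⟫ := by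
    rw [Complex.add_re, Complex.ofReal_re, Complex.re_mul_ofReal]
  rw [hre]
  have h1 : s.re * ⟪ξ, x⟫ ≤ R * (‖ξ‖ * ‖x‖) := by
    calc s.re * ⟪ξ, x⟫ ≤ |s.re * ⟪ξ, x⟫| := le_abs_self _
      _ = |s.re| * |⟪ξ, x⟫| := abs_mul _ _
      _ ≤ R * (‖ξ‖ * ‖x‖) := mul_le_mul ((Complex.abs_re_le_norm s).trans hs) (abs_real_inner_le_norm ξ x)
          (abs_nonneg _) ((norm_nonneg _).trans hs)
  have hR : 0 ≤ R := (norm_nonneg _).trans hs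
  -- AM–GM
  have h2 : R * (‖ξ‖ * ‖x‖) ≤ b / 2 * ‖x‖ ^ 2 + R ^ 2 * ‖ξ‖ ^ 2 / (2 * b) := by
    have heq : b / 2 * ‖x‖ ^ 2 + R ^ 2 * ‖ξ‖ ^ 2 / (2 * b) - R * (‖ξ‖ * ‖x‖) = (b * ‖x‖ - R * ‖ξ‖) ^ 2 / (2 * b) := by
      field_simp; ring
    have hnn : 0 ≤ (b * ‖x‖ - R * ‖ξ‖) ^ 2 / (2 * b) := by positivity
    linarith
  linarith

/-! ## § 2. The complex generating identity -/

/-- ★ **The Fourier–Laplace transform of a harmonic Gaussian (complex generating identity).**  For `H` harmonic homogeneous of degree `k`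
on `ℝⁿ`, `b > 0`, `ξ ∈ ℝⁿ` and every `s ∈ ℂ`:
`∫ H(x) e^{−b‖x‖² + s⟪ξ,x⟫} dx = (π/b)^{n/2} e^{s²‖ξ‖²/(4b)} (s/(2b))^k H(ξ)`. [cite: SteinWeiss1971, Ch. IV Thm. 3.4] -/
theorem integral_eval_mul_cexp_inner (H : MvPolynomial (Fin n) ℝ) {k : ℕ} (hHk : H.IsHomogeneous k)
    (hH : ∑ i, pderiv i (pderiv i H) = 0) {b : ℝ} (hb : 0 < b) (ξ : EuclideanSpace ℝ (Fin n)) (s : ℂ) :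
    ∫ x : EuclideanSpace ℝ (Fin n), ((eval (WithLp.ofLp x) H : ℝ) : ℂ) *
        Complex.exp (((-(b * ‖x‖ ^ 2) : ℝ) : ℂ) + s * ((⟪ξ, x⟫ : ℝ) : ℂ))
      = (((Real.pi / b) ^ (n / 2 : ℝ) : ℝ) : ℂ) * Complex.exp (s ^ 2 * ((‖ξ‖ ^ 2 : ℝ) : ℂ) / (4 * (b : ℂ)))
          * ((s / (2 * (b : ℂ))) ^ k * ((eval (WithLp.ofLp ξ) H : ℝ) : ℂ)) := by
  -- the two entire functions
  set F : ℂ → ℂ := fun s => ∫ x : EuclideanSpace ℝ (Fin n), ((eval (WithLp.ofLp x) H : ℝ) : ℂ) *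
      Complex.exp (((-(b * ‖x‖ ^ 2) : ℝ) : ℂ) + s * ((⟪ξ, x⟫ : ℝ) : ℂ)) with hF
  set G : ℂ → ℂ := fun s => (((Real.pi / b) ^ (n / 2 : ℝ) : ℝ) : ℂ) * Complex.exp (s ^ 2 * ((‖ξ‖ ^ 2 : ℝ) : ℂ) / (4 * (b : ℂ)))
      * ((s / (2 * (b : ℂ))) ^ k * ((eval (WithLp.ofLp ξ) H : ℝ) : ℂ)) with hG
  change F s = G s
  -- (1) agreement on the reals
  have hreal : ∀ t : ℝ, F (t : ℂ) = G (t : ℂ) := by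
    intro t
    have h := integral_eval_mul_exp_inner H hHk hH hb ξ t
    have hL : F (t : ℂ) = ((∫ x : EuclideanSpace ℝ (Fin n),
        eval (WithLp.ofLp x) H * Real.exp (-(b * ‖x‖ ^ 2) + t * ⟪ξ, x⟫) : ℝ) : ℂ) := by
      rw [hF, ← integral_complex_ofReal]
      refine integral_congr_ae (Filter.Eventually.of_forall fun x => ?_)
      simp only [Complex.ofReal_mul, Complex.ofReal_exp]
      push_cast
      ring_nf
    rw [hL, h, hG]
    push_cast
    ring
  -- (2) `F` is entire: differentiate under the integral sign
  have hint : ∀ (Q : MvPolynomial (Fin n) ℝ) (s₀ : ℂ), Integrable (fun x : EuclideanSpace ℝ (Fin n) =>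
      ((eval (WithLp.ofLp x) Q : ℝ) : ℂ) * Complex.exp (((-(b * ‖x‖ ^ 2) : ℝ) : ℂ) + s₀ * ((⟪ξ, x⟫ : ℝ) : ℂ))) := by
    intro Q s₀
    have hc : Continuous fun x : EuclideanSpace ℝ (Fin n) =>
        ((eval (WithLp.ofLp x) Q : ℝ) : ℂ) * Complex.exp (((-(b * ‖x‖ ^ 2) : ℝ) : ℂ) + s₀ * ((⟪ξ, x⟫ : ℝ) : ℂ)) := by
      refine Continuous.mul ?_ (by fun_prop)
      exact Complex.continuous_ofReal.comp
        ((Literature.Topology.FourManifolds.contDiff_mvPolynomial_eval_ofLp Q (N := 0)).continuous)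
    refine (((integrable_eval_mul_exp'' Q (half_pos hb)).norm).const_mul
      (Real.exp (‖s₀‖ ^ 2 * ‖ξ‖ ^ 2 / (2 * b)))).mono' hc.aestronglyMeasurable (Filter.Eventually.of_forall fun x => ?_)
    rw [norm_mul, Complex.norm_real, Real.norm_eq_abs, Real.norm_eq_abs, abs_mul, abs_of_pos (Real.exp_pos _)]
    have h := norm_cexp_quadratic_le hb ξ x (le_refl ‖s₀‖)
    have h0 : 0 ≤ |eval (WithLp.ofLp x) Q| := abs_nonneg _
    calc |eval (WithLp.ofLp x) Q| * ‖Complex.exp (((-(b * ‖x‖ ^ 2) : ℝ) : ℂ) + s₀ * ((⟪ξ, x⟫ : ℝ) : ℂ))‖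
        ≤ |eval (WithLp.ofLp x) Q| * (Real.exp (‖s₀‖ ^ 2 * ‖ξ‖ ^ 2 / (2 * b)) * Real.exp (-(b / 2 * ‖x‖ ^ 2))) :=
          mul_le_mul_of_nonneg_left h h0
      _ = Real.exp (‖s₀‖ ^ 2 * ‖ξ‖ ^ 2 / (2 * b)) * (|eval (WithLp.ofLp x) Q| * Real.exp (-(b / 2 * ‖x‖ ^ 2))) := by ring
  have hderiv : ∀ s₀ : ℂ, HasDerivAt F (∫ x : EuclideanSpace ℝ (Fin n), ((eval (WithLp.ofLp x) H : ℝ) : ℂ) *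
      (((⟪ξ, x⟫ : ℝ) : ℂ) * Complex.exp (((-(b * ‖x‖ ^ 2) : ℝ) : ℂ) + s₀ * ((⟪ξ, x⟫ : ℝ) : ℂ)))) s₀ := by
    intro s₀
    -- the polynomial `H · ⟪ξ, ·⟫`
    set Q : MvPolynomial (Fin n) ℝ := H * ∑ i, C (ξ i) * X i with hQ
    have hQeval : ∀ x : EuclideanSpace ℝ (Fin n), eval (WithLp.ofLp x) Q = eval (WithLp.ofLp x) H * ⟪ξ, x⟫ := by
      intro x
      simp only [hQ, map_mul, map_sum, eval_C, eval_X]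
      congr 1
      rw [PiLp.inner_apply]
      simp [mul_comm]
    have key := hasDerivAt_integral_of_dominated_loc_of_deriv_le (μ := (volume : Measure (EuclideanSpace ℝ (Fin n))))
      (x₀ := s₀) (s := Metric.ball s₀ 1)
      (F := fun (s : ℂ) (x : EuclideanSpace ℝ (Fin n)) => ((eval (WithLp.ofLp x) H : ℝ) : ℂ) *
        Complex.exp (((-(b * ‖x‖ ^ 2) : ℝ) : ℂ) + s * ((⟪ξ, x⟫ : ℝ) : ℂ)))
      (F' := fun (s : ℂ) (x : EuclideanSpace ℝ (Fin n)) => ((eval (WithLp.ofLp x) H : ℝ) : ℂ) *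
        (((⟪ξ, x⟫ : ℝ) : ℂ) * Complex.exp (((-(b * ‖x‖ ^ 2) : ℝ) : ℂ) + s * ((⟪ξ, x⟫ : ℝ) : ℂ))))
      (bound := fun x => Real.exp ((‖s₀‖ + 1) ^ 2 * ‖ξ‖ ^ 2 / (2 * b)) *
        (|eval (WithLp.ofLp x) Q| * Real.exp (-(b / 2 * ‖x‖ ^ 2))))
      (Metric.ball_mem_nhds s₀ one_pos) ?_ (hint H s₀) ?_ ?_ ?_ ?_
    · exact key.2
    · exact Filter.Eventually.of_forall fun s => (hint H s).aestronglyMeasurable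
    · have h := (hint Q s₀).aestronglyMeasurable
      refine (h.congr (Filter.Eventually.of_forall fun x => ?_))
      simp only [hQeval]; push_cast; ring
    · refine Filter.Eventually.of_forall fun x s hs => ?_
      have hs' : ‖s‖ ≤ ‖s₀‖ + 1 := by
        have := mem_ball_iff_norm.mp hs
        calc ‖s‖ = ‖s₀ + (s - s₀)‖ := by rw [add_sub_cancel]
          _ ≤ ‖s₀‖ + ‖s - s₀‖ := norm_add_le _ _
          _ ≤ ‖s₀‖ + 1 := by linarith
      rw [norm_mul, norm_mul, Complex.norm_real, Complex.norm_real, Real.norm_eq_abs, Real.norm_eq_abs, ← mul_assoc,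
        ← abs_mul, ← hQeval]
      have h := norm_cexp_quadratic_le hb ξ x hs'
      have h0 : 0 ≤ |eval (WithLp.ofLp x) Q| := abs_nonneg _
      calc |eval (WithLp.ofLp x) Q| * ‖Complex.exp (((-(b * ‖x‖ ^ 2) : ℝ) : ℂ) + s * ((⟪ξ, x⟫ : ℝ) : ℂ))‖
          ≤ |eval (WithLp.ofLp x) Q| * (Real.exp ((‖s₀‖ + 1) ^ 2 * ‖ξ‖ ^ 2 / (2 * b)) * Real.exp (-(b / 2 * ‖x‖ ^ 2))) :=
            mul_le_mul_of_nonneg_left h h0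
        _ = Real.exp ((‖s₀‖ + 1) ^ 2 * ‖ξ‖ ^ 2 / (2 * b)) * (|eval (WithLp.ofLp x) Q| * Real.exp (-(b / 2 * ‖x‖ ^ 2))) := by
            ring
    · have hI := ((integrable_eval_mul_exp'' Q (half_pos hb)).norm).const_mul
        (Real.exp ((‖s₀‖ + 1) ^ 2 * ‖ξ‖ ^ 2 / (2 * b)))
      refine hI.congr (Filter.Eventually.of_forall fun x => ?_)
      simp only [norm_mul, Real.norm_eq_abs, abs_of_pos (Real.exp_pos _)]
    · refine Filter.Eventually.of_forall fun x s _ => ?_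
      have h1 : HasDerivAt (fun s : ℂ => ((-(b * ‖x‖ ^ 2) : ℝ) : ℂ) + s * ((⟪ξ, x⟫ : ℝ) : ℂ)) (1 * ((⟪ξ, x⟫ : ℝ) : ℂ)) s :=
        ((hasDerivAt_id s).mul_const _).const_add _
      have h2 := (h1.cexp).const_mul (((eval (WithLp.ofLp x) H : ℝ) : ℂ))
      refine h2.congr_deriv ?_
      ring
  have hFan : AnalyticOnNhd ℂ F Set.univ := fun s _ =>
    (show Differentiable ℂ F from fun s₀ => (hderiv s₀).differentiableAt).analyticAt s
  have hGan : AnalyticOnNhd ℂ G Set.univ := by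
    intro s _
    refine Differentiable.analyticAt ?_ s
    rw [hG]
    fun_prop
  -- (3) identity theorem: `F = G` near `0` along the reals, hence everywhere
  have hfreq : ∃ᶠ z in 𝓝[≠] (0 : ℂ), F z = G z := by
    have htend : Tendsto (fun t : ℝ => (t : ℂ)) (𝓝[≠] (0 : ℝ)) (𝓝[≠] (0 : ℂ)) := by
      refine tendsto_nhdsWithin_iff.2 ⟨?_, ?_⟩
      · exact (Complex.continuous_ofReal.tendsto 0).mono_left nhdsWithin_le_nhds |>.congr (fun _ => rfl) |> fun h => by
          simpa using h
      · exact eventually_nhdsWithin_of_forall fun t (ht : t ≠ 0) => by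
          simpa using ht
    haveI : (𝓝[≠] (0 : ℝ)).NeBot := NormedField.nhdsNE_neBot 0
    exact htend.frequently (Filter.Eventually.of_forall hreal).frequently
  have hFG := AnalyticOnNhd.eq_of_frequently_eq hFan hGan hfreq
  exact congrFun hFG s

/-! ## § 3. Hecke's identity -/

/-- ★ **HECKE'S IDENTITY** (Bochner–Hecke for Gaussians): for `H` harmonic homogeneous of degree `k` on `ℝⁿ`, `b > 0`, `ξ ∈ ℝⁿ`,
`∫ H(x) e^{−b‖x‖²} e^{−i⟪ξ,x⟫} dx = (π/b)^{n/2} (−i/(2b))^k H(ξ) e^{−‖ξ‖²/(4b)}`. [cite: SteinWeiss1971, Ch. IV Thm. 3.4] -/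
theorem hecke_identity (H : MvPolynomial (Fin n) ℝ) {k : ℕ} (hHk : H.IsHomogeneous k)
    (hH : ∑ i, pderiv i (pderiv i H) = 0) {b : ℝ} (hb : 0 < b) (ξ : EuclideanSpace ℝ (Fin n)) :
    ∫ x : EuclideanSpace ℝ (Fin n), ((eval (WithLp.ofLp x) H : ℝ) : ℂ) * ((Real.exp (-(b * ‖x‖ ^ 2)) : ℝ) : ℂ) *
        Complex.exp (-Complex.I * ((⟪ξ, x⟫ : ℝ) : ℂ))
      = (((Real.pi / b) ^ (n / 2 : ℝ) : ℝ) : ℂ) * (-Complex.I / (2 * (b : ℂ))) ^ k * ((eval (WithLp.ofLp ξ) H : ℝ) : ℂ)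
          * ((Real.exp (-(‖ξ‖ ^ 2 / (4 * b))) : ℝ) : ℂ) := by
  have h := integral_eval_mul_cexp_inner H hHk hH hb ξ (-Complex.I)
  have hL : ∫ x : EuclideanSpace ℝ (Fin n), ((eval (WithLp.ofLp x) H : ℝ) : ℂ) * ((Real.exp (-(b * ‖x‖ ^ 2)) : ℝ) : ℂ) *
        Complex.exp (-Complex.I * ((⟪ξ, x⟫ : ℝ) : ℂ))
      = ∫ x : EuclideanSpace ℝ (Fin n), ((eval (WithLp.ofLp x) H : ℝ) : ℂ) *
        Complex.exp (((-(b * ‖x‖ ^ 2) : ℝ) : ℂ) + (-Complex.I) * ((⟪ξ, x⟫ : ℝ) : ℂ)) := by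
    refine integral_congr_ae (Filter.Eventually.of_forall fun x => ?_)
    simp only [Complex.exp_add, Complex.ofReal_exp]; ring
  rw [hL, h]
  have hI : (-Complex.I) ^ 2 = -1 := by rw [neg_sq, Complex.I_sq]
  rw [hI, show (-1 : ℂ) * ((‖ξ‖ ^ 2 : ℝ) : ℂ) / (4 * (b : ℂ)) = ((-(‖ξ‖ ^ 2 / (4 * b)) : ℝ) : ℂ) by push_cast; ring,
    ← Complex.ofReal_exp]
  ring

/-- ★ **Hecke's identity, cosine form**: for `H` harmonic homogeneous of degree `k` on `ℝⁿ`, `b > 0`, `ξ ∈ ℝⁿ`,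
`∫ H(x) e^{−b‖x‖²} cos⟪ξ,x⟫ dx = (π/b)^{n/2} · Re((−i/(2b))^k) · H(ξ) e^{−‖ξ‖²/(4b)}` (for even `k = 2m` the middle factor is
`(−1)^m/(2b)^k`, for odd `k` it is `0`) — the form consumed by Laplace–Fourier (cosine) representations. [cite: SteinWeiss1971, Ch. IV Thm. 3.4] -/
theorem integral_eval_mul_exp_mul_cos (H : MvPolynomial (Fin n) ℝ) {k : ℕ} (hHk : H.IsHomogeneous k)
    (hH : ∑ i, pderiv i (pderiv i H) = 0) {b : ℝ} (hb : 0 < b) (ξ : EuclideanSpace ℝ (Fin n)) :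
    ∫ x : EuclideanSpace ℝ (Fin n), eval (WithLp.ofLp x) H * Real.exp (-(b * ‖x‖ ^ 2)) * Real.cos ⟪ξ, x⟫
      = (Real.pi / b) ^ (n / 2 : ℝ) * ((-Complex.I / (2 * (b : ℂ))) ^ k).re * eval (WithLp.ofLp ξ) H
          * Real.exp (-(‖ξ‖ ^ 2 / (4 * b))) := by
  have h := hecke_identity H hHk hH hb ξ
  -- integrability of the complex integrand
  have hint : Integrable (fun x : EuclideanSpace ℝ (Fin n) => ((eval (WithLp.ofLp x) H : ℝ) : ℂ) *
      ((Real.exp (-(b * ‖x‖ ^ 2)) : ℝ) : ℂ) * Complex.exp (-Complex.I * ((⟪ξ, x⟫ : ℝ) : ℂ))) := by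
    have hc : Continuous fun x : EuclideanSpace ℝ (Fin n) => ((eval (WithLp.ofLp x) H : ℝ) : ℂ) *
        ((Real.exp (-(b * ‖x‖ ^ 2)) : ℝ) : ℂ) * Complex.exp (-Complex.I * ((⟪ξ, x⟫ : ℝ) : ℂ)) := by
      refine Continuous.mul (Continuous.mul ?_ (by fun_prop)) (by fun_prop)
      exact Complex.continuous_ofReal.comp
        ((Literature.Topology.FourManifolds.contDiff_mvPolynomial_eval_ofLp H (N := 0)).continuous)
    refine ((integrable_eval_mul_exp'' H hb).norm).mono' hc.aestronglyMeasurable (Filter.Eventually.of_forall fun x => ?_)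
    rw [norm_mul, norm_mul, Complex.norm_real, Complex.norm_real, Complex.norm_exp]
    have hre : (-Complex.I * ((⟪ξ, x⟫ : ℝ) : ℂ)).re = 0 := by simp
    rw [hre, Real.exp_zero, mul_one, norm_mul]
  have hre := congrArg Complex.re h
  rw [show (∫ x : EuclideanSpace ℝ (Fin n), ((eval (WithLp.ofLp x) H : ℝ) : ℂ) * ((Real.exp (-(b * ‖x‖ ^ 2)) : ℝ) : ℂ) *
      Complex.exp (-Complex.I * ((⟪ξ, x⟫ : ℝ) : ℂ))).re = RCLike.re (∫ x : EuclideanSpace ℝ (Fin n),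
      ((eval (WithLp.ofLp x) H : ℝ) : ℂ) * ((Real.exp (-(b * ‖x‖ ^ 2)) : ℝ) : ℂ) * Complex.exp (-Complex.I * ((⟪ξ, x⟫ : ℝ) : ℂ)))
      from rfl, ← integral_re hint] at hre
  have hpt : ∀ x : EuclideanSpace ℝ (Fin n), RCLike.re (((eval (WithLp.ofLp x) H : ℝ) : ℂ) * ((Real.exp (-(b * ‖x‖ ^ 2)) : ℝ) : ℂ) *
      Complex.exp (-Complex.I * ((⟪ξ, x⟫ : ℝ) : ℂ)))
      = eval (WithLp.ofLp x) H * Real.exp (-(b * ‖x‖ ^ 2)) * Real.cos ⟪ξ, x⟫ := by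
    intro x
    rw [RCLike.re_to_complex, ← Complex.ofReal_mul, Complex.re_ofReal_mul, Complex.exp_re]
    simp [Real.cos_neg]
  simp_rw [hpt] at hre
  rw [hre]
  simp only [Complex.mul_re, Complex.ofReal_re, Complex.ofReal_im, mul_zero, sub_zero, zero_mul]

end Literature.Analysis.Fourier

end
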